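import Summits.BirchSwinnertonDyer.BirchSwinnertonDyer.Theorems.Rank1ResidualJetSwapLevelRaisingLiterature
import Summits.BirchSwinnertonDyer.BirchSwinnertonDyer.Theorems.ErratumRoadFiveNonSurjCornerKolyJSwapLevelRaisingIrr
import Summits.BirchSwinnertonDyer.BirchSwinnertonDyer.Theorems.ErratumRoadFiveNonSurjCornerKolyJWalkHlevOfSelmerSupply
import Summits.BirchSwinnertonDyer.BirchSwinnertonDyer.Theorems.ErratumRoadFiveNonSurjCornerKolyJSelmerSupplyCorner
import Summits.BirchSwinnertonDyer.BirchSwinnertonDyer.Theorems.ErratumRoadFiveNonSurjCornerKolyJRedefinitionSharp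
import Summits.BirchSwinnertonDyer.BirchSwinnertonDyer.Theorems.KatoDescentPotSupersingularWildJetchevBoundAtPHeegnerE0ImageFree
import HarnessLib

/-!
# Route `ErratumRoadFive` (rung K2), crux child `NonSurjCornerKolyJ` (item stmt-BirchSwinnertonDyer-19947) — DISPLAY v6: the
# registered stub `stub_kolyJ_max` ⟸ THREE NAMED LITERATURE FACTS {Gross 1991 Prop. 3.7 (2), Poitou–Tate for Selmer structures,
# Gross 1991 §6 ∕ [GZ86 III (3.1)] image-free} + `−1 ∈ ρ̄_{E,7}(Γ_ℚ)` on the `p = 7` pairs — NO SUPPLY HYPOTHESIS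
# (cell `bsd-stepL`, seat `bsd-stepL-corner-p1` g11; `--supports stmt-BirchSwinnertonDyer-19947`)

WHY/WHAT. (1) `Swap.levelRaising_of_literature_of_irreducible` — Kolyvagin's PRIME SWAP («level raising at minimal depth», the
content of McCallum 1991 Prop. 5.2 with `C = {0}`) on the irreducible corner from {Poitou–Tate, image-free GZ III (3.1), Gross
3.7 (2)}: bsd-jet pv-2's `levelRaising_of_literature` (18:34Z today, `ρ̄` onto) ported through bricks 2a ∕ 2b ∕ 4 (irr)
(`…KolyJSwapPrimeIrr`, `…SwapStepIrr`, `…SwapLevelRaisingIrr`): admissibility from x11b3 `NoTorsionIrr`, Čebotarev from this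
seat's `…_of_irr_of_neg`, `ι_*` injective from `E(K)[p] = 0`, McCallum 4.4 from Gross 3.7 (2) BY NAME for ANY two data, hGZ from
bsd-potss's image-free `forall_hGZ_of_Gross1991_imageFree`. (2) `nonSurjCornerKolyJ_max_of_namedFacts` — the registered signature of
`stub_kolyJ_max` VERBATIM from `h37`, `hPT`, `hF1` and `hneg7` ONLY: g8's `nonSurjCornerKolyJ_max_of_swap_of_perLevel'`
(stub ⟸ hswap + hlev) with hswap := (1) and hlev := `hlev_of_frobeniusCongruence_of_selmerSupply` ∘
`selmerSupplyCorner_of_poitouTate_Gross1991` (this session). HONEST FRAMING: CONDITIONAL on three published, typed,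
unformalised facts (Eichler–Shimura congruence; Poitou–Tate nine-term duality for Selmer structures; GZ86 III (3.1)) and on
`−1 ∈ ρ̄_{E,7}(Γ_ℚ)` (genuine at 7; automatic at 5); no definition ∕ fact ∕ sorry; the stub is NOT discharged; no item closes;
nothing about any curve's BSD; BSD is not advanced; T7. Credit: bsd-jet (swap kernel), tam3-p1 (walk, supplies), bsd-potss
(image-free GZ, root-class leaves), x11b3 (NoTorsionIrr, h44 programme), lit (Gross 3.7 (2) typed), shim3b (injectivity).
References (locators only): [cite: Jetchev2008, Thm. 1.4 (p. 812), §3–§6] [cite: McCallumLMS1991, §4 Prop. 4.4, §5 Prop. 5.2 and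
proof (pp. 304–306)] [cite: GrossLMS1991, Prop. 3.7 (2), §6 proof of Prop. 6.2 (1)] [cite: Nekovar2007, Prop. 4.13 (ii)]
[cite: GrossZagier1986, III (3.1)] [cite: MilneADT2006, Ch. I, Thm. 4.10(b)] [cite: BurungaleEtAl2026, Prop. 2.2.1].
-/

set_option autoImplicit false

noncomputable section

open scoped Classical Pointwise
open Function NumberField IsDedekindDomain WeierstrassCurve Field
open Literature.NumberTheory.EllipticCurves Literature.NumberTheory.GaloisRepresentations
open Literature.NumberTheory.EllipticCurves.Jetchev2008 Literature.NumberTheory.EllipticCurves.KolyvaginCocycle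
open Literature.NumberTheory.EllipticCurves.ModularForms
open Literature.NumberTheory.GaloisCohomology Literature.NumberTheory.Automorphic
open Literature.NumberTheory.GaloisRepresentations.DiscreteGaloisModule (transverseSubgroup SelmerStructure)
open Summit.BirchSwinnertonDyer.Rank1Residual.JET.SelmerVocabulary
open Summit.BirchSwinnertonDyer.Rank1Residual.JET.GlobalDuality
open Summit.BirchSwinnertonDyer.Rank1Residual.X11b
open Summit.BirchSwinnertonDyer.Rank1Residual.X11b.Three
open Summit.BirchSwinnertonDyer.BirchSwinnertonDyer.Theorems

open Summit.BirchSwinnertonDyer.BirchSwinnertonDyer.Theorems.HeegnerE0ImageFree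
open Summit.BirchSwinnertonDyer.Rank1Residual.X11b.Three.Koly

namespace Summit.BirchSwinnertonDyer.Rank1Residual.JET.Swap

set_option maxHeartbeats 800000 in
/-- **LEVEL RAISING AT MINIMAL DEPTH on the IRREDUCIBLE corner from three named Literature statements** (`hPT` Poitou–Tate,
`hF1` image-free [GZ86 III (3.1)], `h372` Gross 3.7 (2)) — bsd-jet's `levelRaising_of_literature` with `¬CM`∕tower ↦ `p ≠ 3`,
`E[p]` irreducible, `p` split in `K`, `−1 ∈ ρ̄(Γ_ℚ)`, a disjointness prime `q₀ ∣ d_K`; proof = bsd-jet's assembly with the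
image-free `hGZ` (bsd-potss) and brick 4 (irr). [cite: McCallumLMS1991, §5 Prop. 5.2 (p. 304)]
[cite: Jetchev2008, Lemma 5.1, Lemma 5.2 (iii)] [cite: GrossZagier1986, III (3.1)] -/
theorem levelRaising_of_literature_of_irreducible
    (hPT : ∀ (K : Type) [Field K] [NumberField K], poitouTate_selmerStructure_duality_conj K)
    (hF1 : Gross1991_heegnerPoint_sub_ratTorsion_mem_E0_imageFree)
    (h372 : GrossLMS1991.prop37_2_frobeniusCongruence) :
    ∀ (W : WeierstrassCurve ℚ) [W.IsElliptic] [W.IsGloballyMinimal] [NeZero (W.conductorNorm ℤ)]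
      (K : Type) [Field K] [NumberField K], IsImaginaryQuadratic K →
      NumberField.discr K ≠ -3 → NumberField.discr K ≠ -4 →
      SatisfiesHeegnerHypothesis (W.conductorNorm ℤ) K →
      ∀ (p : ℕ) [Fact p.Prime], p ≠ 2 → p ≠ 3 → W.HasIrreducibleModPGaloisRep p → SatisfiesHeegnerHypothesis p K →
      (∃ γ : Field.absoluteGaloisGroup ℚ, ∀ P : geomTorsion W p, γ • P = -P) →
      ∀ {q₀ : ℕ}, q₀.Prime → (q₀ : ℤ) ∣ NumberField.discr K → ¬ q₀ ∣ W.conductorNorm ℤ → q₀ ≠ p →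
      ∀ (Dt : ModularParametrizationData W (W.conductorNorm ℤ)) (β : ℤ) (ι : K →+* ℂ) (u : ℕ),
      (∀ (c : ℕ), Squarefree c →
        (∀ q ∈ c.primeFactors, Zhang2014.IsKolyvaginPrime (W.conductorNorm ℤ) W K p q ∧
          1 + u ≤ Zhang2014.kolyvaginIndex W p q) →
        ∀ dc : KolyvaginHeegnerData Dt β ι c,
        ∃ Q : (W.baseChange (ringClassField K ι c)).toAffine.Point,
          ((p ^ u : ℕ) : ℤ) • Q = dc.derivedPoint) →
      ∀ (n₀ : ℕ), Squarefree n₀ →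
        (∀ q ∈ n₀.primeFactors, Zhang2014.IsKolyvaginPrime (W.conductorNorm ℤ) W K p q ∧
          1 + u ≤ Zhang2014.kolyvaginIndex W p q) →
        ∀ d₀ : KolyvaginHeegnerData Dt β ι n₀,
        (¬ ∃ Q : (W.baseChange (ringClassField K ι n₀)).toAffine.Point,
          ((p ^ (u + 1) : ℕ) : ℤ) • Q = d₀.derivedPoint) →
        ∀ m' : ℕ, ∃ (n : ℕ) (d : KolyvaginHeegnerData Dt β ι n), Squarefree n ∧
          (∀ q ∈ n.primeFactors, Zhang2014.IsKolyvaginPrime (W.conductorNorm ℤ) W K p q ∧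
            max m' (1 + u) ≤ Zhang2014.kolyvaginIndex W p q) ∧
          ¬ ∃ Q : (W.baseChange (ringClassField K ι n)).toAffine.Point,
            ((p ^ (u + 1) : ℕ) : ℤ) • Q = d.derivedPoint := by
  intro W _ _ _ K _ _ hK hD3 hD4 hH p _ hp2 hp3 hirr hHp hneg q₀ hq₀ hq₀d hq₀N hq₀p Dt β ι u hmin n₀ hn₀ hn₀K d₀ hd₀ m'
  have hp : p.Prime := Fact.out
  have hD : NumberField.discr K < -4 := KolyvaginAssembly.discr_lt_neg_four hK ⟨hD3, hD4⟩
  haveI : ∀ j : ℕ, NumberField (ringClassField K ι j) := numberField_ringClassField K hK ι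
  obtain ⟨τ, hτ⟩ := exists_algEquiv_ne_one_of_isImaginaryQuadratic K hK
  have hττ : τ * τ = 1 := mul_self_eq_one_of_isImaginaryQuadratic hK τ
  -- instances at level `p`
  haveI : NeZero (p ^ 1) := ⟨pow_ne_zero 1 hp.ne_zero⟩
  haveI : Finite (geomTorsion (W.baseChange K) ((p ^ 1 : ℕ) : ℤ)) :=
    finite_geomTorsion_of_neZero (W.baseChange K) (p ^ 1)
  -- the Poitou–Tate package and a `τ`-equivariant Weil datum at level `p`
  obtain ⟨inv, hperf, hvan, -, hSC, hconj⟩ := hPT K (p ^ 1)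
  have h2 : 2 ≤ p ^ 1 := by rw [pow_one]; exact hp.two_le
  obtain ⟨e, hμ, hadd₁, hadd₂, hgal, halt, hnondeg, hτe⟩ := exists_weilDatum_liftAut W τ (p ^ 1) h2
  -- the global intrinsic transverse family at level `p` and its local facts
  obtain ⟨𝒯, h𝒯, -⟩ := Walk.exists_globalTransverseFamily W ι ((p ^ 1 : ℕ) : ℤ)
  have h𝒯σ' : ∀ (c : ℕ), Squarefree c →
      (∀ q ∈ c.primeFactors, Zhang2014.IsKolyvaginPrime (W.conductorNorm ℤ) W K p q) →
      ∀ (v w : HeightOneSpectrum (𝓞 K)) (h : τ • v = w), v ∈ placesDividing K c →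
      ∀ x : galoisCohomology (((W.baseChange K).torsionGaloisModule ((p ^ 1 : ℕ) : ℤ)).toLocal
        (Sum.inr v : Place K)) 1,
      x ∈ 𝒯 (Sum.inr v) → conjActPlace W τ ((p ^ 1 : ℕ) : ℤ) h x ∈ 𝒯 (Sum.inr w) :=
    fun c hc _ v w h hv x hx ↦ Walk.globalTransverse_conjActPlace_mem h𝒯 τ hc
      (forall_conjActPlace_mem_of_eq_iInf_transverseSubgroup W hK ι τ _ c) v w h hv x hx
  have h𝒯sd' : ∀ (c : ℕ), Squarefree c →
      (∀ q ∈ c.primeFactors, Zhang2014.IsKolyvaginPrime (W.conductorNorm ℤ) W K p q) →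
      ∀ v ∈ placesDividing K c,
      inv.dualTransported 𝒯 (weilDualIntertwining (W.baseChange K) (p ^ 1) e hμ hadd₁ hadd₂ hgal)
        (Sum.inr v) = 𝒯 (Sum.inr v) :=
    fun c hc hcK ↦ Walk.globalTransverse_dualTransported_eq (ι := ι) h𝒯 hc
      (fun 𝒯c h𝒯c inv' hperf' w' hw' ↦
        RingClassTransverse.dualTransported_eq_of_localTransverseFamily W K hK hD ι p hp2 1 le_rfl c hc
          hcK (fun ℓ hℓ ↦ (hcK ℓ hℓ).2.2.2.2.2) 𝒯c h𝒯c e hμ hadd₁ hadd₂ hgal halt hnondeg inv' hperf' w' hw')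
      inv hperf
  have hloc' : ∀ ℓ : ℕ, Zhang2014.IsKolyvaginPrime (W.conductorNorm ℤ) W K p ℓ →
      1 ≤ Zhang2014.kolyvaginIndex W p ℓ →
      ∀ (v : HeightOneSpectrum (𝓞 K)), (ℓ : 𝓞 K) ∈ v.asIdeal → ∀ (hfix : τ • v = v) (s : ℤ),
      (s = 1 ∨ s = -1) →
      ((W.baseChange K).kummerSelmerStructure ((p ^ 1 : ℕ) : ℤ) (Sum.inr v)).relIndex
        ((conjActPlace W τ ((p ^ 1 : ℕ) : ℤ) hfix - s • AddMonoidHom.id _).ker) = p ^ 1 :=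
    fun ℓ hℓ hk v hv hfix s hs ↦
      kolyvaginLocalTerm_of_poitouTate hPT W K hK τ hτ p 1 hp2 le_rfl ℓ hℓ hk v hv hfix s hs
  have hdisj' : ∀ ℓ : ℕ, Zhang2014.IsKolyvaginPrime (W.conductorNorm ℤ) W K p ℓ →
      ∀ v : HeightOneSpectrum (𝓞 K), (ℓ : 𝓞 K) ∈ v.asIdeal →
      Disjoint ((W.baseChange K).kummerSelmerStructure ((p ^ 1 : ℕ) : ℤ) (Sum.inr v)) (𝒯 (Sum.inr v)) :=
    fun ℓ hℓ v hv ↦ Walk.globalTransverse_disjoint_kummer h𝒯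
      (P := fun ℓ ↦ Zhang2014.IsKolyvaginPrime (W.conductorNorm ℤ) W K p ℓ)
      (fun ℓ hℓ w hw ↦ Walk.disjoint_kummer_iInf_transverseSubgroup W K hK hD ι 1 hℓ w hw)
      (fun ℓ hℓ ↦ hℓ.1) ℓ hℓ v hv
  -- [GZ86 III (3.1)] (guarded) from F1; McCallum 4.4 from Gross 3.7 (2)
  obtain ⟨n', hcop', hGZ'⟩ := HeegnerE0ImageFree.forall_hGZ_of_Gross1991_imageFree hF1 W K hK hD3 hD4 hH p hp2 hirr Dt β ι
  exact exists_conductor_levelIndex_ge_of_minDepth_of_irreducible W τ p e hμ hadd₁ hadd₂ hgal halt hnondeg hτe hK hD3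
    hD4 hH hp2 hp3 hirr hHp hneg hq₀ hq₀d hq₀N hq₀p hτ hττ Dt β ι h372 inv hperf hvan hSC (hconj τ)
    𝒯 h𝒯 h𝒯σ' h𝒯sd' hloc' hdisj' hcop' hGZ' hmin hn₀ hn₀K d₀ hd₀ m'

end Summit.BirchSwinnertonDyer.Rank1Residual.JET.Swap

namespace Summit.BirchSwinnertonDyer.Rank1Residual.X11b.Three.Koly

open WeierstrassCurve IsDedekindDomain NumberField Field Literature.NumberTheory.EllipticCurves
  Literature.NumberTheory.EllipticCurves.ModularForms Literature.NumberTheory.EllipticCurves.Jetchev2008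
  Literature.NumberTheory.EllipticCurves.Rank1Residual Literature.NumberTheory.GaloisRepresentations
  Summit.BirchSwinnertonDyer.Rank1Residual Summit.BirchSwinnertonDyer.Rank1Residual.X11b
  Summit.BirchSwinnertonDyer.Rank1Residual.JET Summit.BirchSwinnertonDyer.BirchSwinnertonDyer.Theorems

/-- **DISPLAY v6 — `stub_kolyJ_max` ⟸ THREE NAMED LITERATURE FACTS {Gross 1991 Prop. 3.7 (2), Poitou–Tate for Selmer
structures, Gross 1991 §6 ∕ [GZ86 III (3.1)] image-free} + `−1 ∈ ρ̄_{E,7}(Γ_ℚ)` on the `p = 7` pairs; NO supply hypothesis.**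
Composition: this seat's g8 `nonSurjCornerKolyJ_max_of_swap_of_perLevel'` (stub ⟸ hswap + hlev) with hswap :=
`Swap.levelRaising_of_literature_of_irreducible` (Kolyvagin's prime swap = McCallum Prop. 5.2's content, bsd-jet's kernel ported
to the irreducible corner) at `u := M`, `m' := e`, and hlev := `hlev_of_frobeniusCongruence_of_selmerSupply` ∘
`selmerSupplyCorner_of_poitouTate_Gross1991`; the disjointness prime from `exists_prime_dvd_discr_of_heegner`, `−1 ∈ ρ̄(Γ_ℚ)`
at `p = 5` from `GaloisImage.exists_smul_eq_neg_five_of_irr`. Versus tam3-p1's `jetchevMaxHLAtThree_of_facts_of_print` (19109 at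
`p = 3`, `ρ̄` onto, SIX named facts) the non-surjective corner at `p ∈ {5,7}` stands modulo THREE of them (McCallum 5.2 and 4.4
replaced by their image-free CONTENT in the kernel; Gross–Zagier ∕ modularity not needed on a corner frame) and the genuine
image restriction `−1 ∈ ρ̄_{E,7}(Γ_ℚ)` (Cartan-normaliser images without `−I` exist at 7). HONEST FRAMING: a CONDITIONAL theorem
(three published, typed, unformalised facts + one image hypothesis at `p = 7`); the registered stub is NOT discharged; no item
closes; nothing about any curve's BSD; BSD is not advanced; T7. [cite: Jetchev2008, Thm. 1.4 (p. 812)]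
[cite: McCallumLMS1991, §4 Prop. 4.4, §5 Prop. 5.2] [cite: GrossLMS1991, Prop. 3.7 (2), §6 Prop. 6.2 (1)]
[cite: GrossZagier1986, III (3.1)] [cite: MilneADT2006, Ch. I, Thm. 4.10(b)] -/
theorem nonSurjCornerKolyJ_max_of_namedFacts
    -- NAMED LITERATURE FACTS (cite-only)
    (h37 : GrossLMS1991.prop37_2_frobeniusCongruence)
    (hPT : ∀ (K : Type) [Field K] [NumberField K], poitouTate_selmerStructure_duality_conj K)
    (hF1 : Gross1991_heegnerPoint_sub_ratTorsion_mem_E0_imageFree)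
    -- the genuine image restriction at `p = 7`
    (hneg7 : ∀ (W : WeierstrassCurve ℚ) [W.IsElliptic] [W.IsGloballyMinimal] [NeZero (W.conductorNorm ℤ)]
      (p : ℕ) [Fact p.Prime], ClassX11b W p → ¬ Surj W p → p = 7 →
      ∃ γ : Field.absoluteGaloisGroup ℚ, ∀ P : geomTorsion W p, γ • P = -P) :
    ∀ (W : WeierstrassCurve ℚ) [W.IsElliptic] [W.IsGloballyMinimal] [NeZero (W.conductorNorm ℤ)]
      (p : ℕ) [Fact p.Prime] (K : Type) [Field K] [NumberField K]
      (Dt : ModularParametrizationData W (W.conductorNorm ℤ)) (β : ℤ) (ι : K →+* ℂ),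
      p ∣ W.tamagawaProduct →
      ClassX11b W p → ¬ Surj W p → (p = 5 ∨ p = 7) → p ∣ padicValInt p W.minimalDiscriminantInt →
      ¬ Ram W p → IsImaginaryQuadratic K → 4 < (NumberField.discr K).natAbs →
      SatisfiesHeegnerHypothesis (W.conductorNorm ℤ) K → SatisfiesHeegnerHypothesis p K →
      (4 * (W.conductorNorm ℤ : ℤ)) ∣ β ^ 2 - NumberField.discr K → ¬ (p : ℤ) ∣ Dt.c →
      ∀ (v : HeightOneSpectrum (𝓞 ℚ)) (s : ℕ), s ≤ padicValNat p (W.tamagawaNumberAt v) →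
        ∀ (n : ℕ) (d : KolyvaginHeegnerData Dt β ι n), Squarefree n →
          (∀ ℓ ∈ n.primeFactors, Zhang2014.IsKolyvaginPrime (W.conductorNorm ℤ) W K p ℓ ∧
            s ≤ Zhang2014.kolyvaginIndex W p ℓ) → PDiv d p s := by
  refine nonSurjCornerKolyJ_max_of_swap_of_perLevel' ?_
    (hlev_of_frobeniusCongruence_of_selmerSupply h37 hneg7 (selmerSupplyCorner_of_poitouTate_Gross1991 hPT hF1))
  intro W _ _ _ p _ K _ _ Dt β ι htam hX hns h57 hvΔ hnr hK' hd hHN hHp hβ hc M e n d hsq hnK hall hnd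
  have hp : p.Prime := Fact.out
  have hp2 : p ≠ 2 := hX.2.1
  have hp3 : p ≠ 3 := by rcases h57 with rfl | rfl <;> decide
  have hirr : W.HasIrreducibleModPGaloisRep p := hX.2.2.2
  have hDneg : NumberField.discr K < 0 := (isImaginaryQuadratic_iff_discr_neg.1 hK').2
  have hD3 : NumberField.discr K ≠ -3 := by omega
  have hD4 : NumberField.discr K ≠ -4 := by omega
  obtain ⟨q₀, hq₀, hq₀d, hq₀N, hq₀p⟩ := exists_prime_dvd_discr_of_heegner hK'.1 hd hHN hHp
  have hneg : ∃ γ : Field.absoluteGaloisGroup ℚ, ∀ P : geomTorsion W p, γ • P = -P := by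
    rcases h57 with rfl | rfl
    · exact GaloisImage.exists_smul_eq_neg_five_of_irr W hirr
    · exact hneg7 W 7 hX hns rfl
  haveI : ∀ j : ℕ, NumberField (ringClassField K ι j) := numberField_ringClassField K hK' ι
  -- minimality at depth `u := M` (index `≥ 1 + M` = `≥ M + 1`)
  have hidx : ∀ {c : ℕ}, (∀ q ∈ c.primeFactors, Zhang2014.IsKolyvaginPrime (W.conductorNorm ℤ) W K p q ∧
      1 + M ≤ Zhang2014.kolyvaginIndex W p q) → ∀ q ∈ c.primeFactors,
      Zhang2014.IsKolyvaginPrime (W.conductorNorm ℤ) W K p q ∧ M + 1 ≤ Zhang2014.kolyvaginIndex W p q :=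
    fun h q hq ↦ ⟨(h q hq).1, by rw [Nat.add_comm]; exact (h q hq).2⟩
  obtain ⟨n', d', hn', hn'K, hnd'⟩ := Swap.levelRaising_of_literature_of_irreducible hPT hF1 h37 W K hK' hD3 hD4 hHN p hp2 hp3
    hirr hHp hneg hq₀ hq₀d hq₀N hq₀p Dt β ι M (fun c hc hcK dc ↦ hall c dc hc (hidx hcK)) n hsq
    (fun q hq ↦ ⟨(hnK q hq).1, by rw [Nat.add_comm]; exact (hnK q hq).2⟩) d
    hnd e
  exact ⟨n', d', hn', fun q hq ↦ ⟨(hn'K q hq).1, le_trans (le_max_left _ _) (hn'K q hq).2⟩, hnd'⟩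

end Summit.BirchSwinnertonDyer.Rank1Residual.X11b.Three.Koly

end
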